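import Mathlib
import Summits.Ventures.PercRepro2.Defs
import Summits.Ventures.PercRepro2.Harris
import Summits.Ventures.PercRepro2.Graph
import Summits.Ventures.PercRepro2.Events
import Summits.Ventures.PercRepro2.TReduction
import Summits.Ventures.PercRepro2.TReductionBase
import Summits.Ventures.PercRepro2.THBaseEnum
import Summits.Ventures.PercRepro2.THClassVEnum
import Summits.Ventures.PercRepro2.THClassVGraph

/-!
# The antipodal base cases of the class-(v) graph at its second negative pair `({x₆ ∈ T}, {x₂, x₄,
    x₅ ∈ T})` as an explicit ten-level enumeration (mine-a g51)

For the class-(v) graph `G₅` (`THClassVGraph`: root `r = 0`, hit vertex `h = 1`, edges `r–x₂, …,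
    r–x₆,
h–x₂, h–x₃, x₂–x₄, x₂–x₅, x₃–x₆`) at the pair `(𝓤, 𝓥') = ({x₆ ∈ T}, {x₂, x₄, x₅ ∈ T})` — the
    second of
the two pairs at which the antipodal base-case hypothesis fails (MINE-A.md §104.3 (C); `THClassV`
    proved
`(T_h)` at the tight pair `({x₆ ∈ T}, {x₄, x₅ ∈ T})`) — the antipodal base case of a pinning
    pattern
(`THBaseEnum.kbGen`) is the explicit ten-level enumeration `enum (s 0) … (s 9)` (`kbGen_eq_enum`,
definitionally), the leaf reading the twenty edge states of the two copies directly (`leaf`; the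
    sign as
`THClassV.tree`).  `kform_eq_enum` is `TReduction.kform` at a base case in this form.  The three
    values
the antipodal-pair certificate needs: the main base case `enum 2 … 2 = −1` (the base-case
    hypothesis
FAILS here) and the antipodal pinnings `x₂ x₅` closed and `x₂ x₅` open (edge `8`), both `= 1`.
No instance, no notation.
-/

namespace Summit.Ventures.PercRepro2

namespace THClassVP2

open Finset TReduction THBaseEnum
open THClassV (tree tree_eq)
open THClassV (ends inC mem_cluster_iff hc r2 r3 r4 r5 r6 Q qB mem_Q_iff U uB mem_U_iff)

section Events

/-- The up-set `𝓥' = {x₂, x₄, x₅ ∈ T}` (`= ↑{r, x₂, x₄, x₅}` on clusters of the root): the second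
negative pair of `G₅` is `(𝓤, 𝓥') = ({x₆ ∈ T}, {x₂, x₄, x₅ ∈ T})` (MINE-A.md §104.3 (C);
    `THClassV`
proved `(T_h)` at the tight pair `({x₆ ∈ T}, {x₄, x₅ ∈ T})`). -/
def 𝓥' : Set (Set (Fin 7)) := {T | (2 : Fin 7) ∈ T ∧ (4 : Fin 7) ∈ T ∧ (5 : Fin 7) ∈ T}

/-- `𝓥'` is an up-set. -/
lemma isUpperSet_𝓥' : IsUpperSet 𝓥' := fun _ _ h hT => ⟨h hT.1, h hT.2.1, h hT.2.2⟩

/-- The event `e' = {C_r ∈ 𝓥'} = {x₂, x₄, x₅ ∈ C_r}`. -/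
def e' : Set (Config (Fin 10)) := clusterInEvent ends 0 𝓥'

/-- `e'` is decided by `inC · 2 && inC · 4 && inC · 5`. -/
def eB' (ω : Config (Fin 10)) : Bool := inC ω 2 && inC ω 4 && inC ω 5

/-- `e'` is decided by `eB'`. -/
lemma mem_e'_iff (ω : Config (Fin 10)) : ω ∈ e' ↔ eB' ω = true := by
  simp only [e', mem_clusterInEvent, 𝓥', Set.mem_setOf_eq, mem_cluster_iff, eB', Bool.and_eq_true,
    and_assoc]

end Events

section Leaf

/-- The leaf: the sign at the two copies `ω₁ = (l2, l3, l4, l5, l6, h2, h3, a, b, c)`, `ω₂ = (l2',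
    l3', l4', l5', l6', h2', h3', a', b', c')`, the five
Booleans computed from the reachability formulas of `THClassVGraph`. -/
def leaf (l2 l3 l4 l5 l6 h2 h3 a b c l2' l3' l4' l5' l6' h2' h3' a' b' c' : Bool) : ℤ :=
  tree (hc l2 l3 l4 l5 l6 h2 h3 a b c)
    ((r6 l3 l6 c || (hc l2 l3 l4 l5 l6 h2 h3 a b c && h3 && c)))
    ((r6 l3' l6' c' || (hc l2' l3' l4' l5' l6' h2' h3' a' b' c' && h3' && c')))
    ((r2 l2 l4 l5 a b || (hc l2 l3 l4 l5 l6 h2 h3 a b c && h2)) && (r4 l2 l4 l5 a b || (hc l2 l3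
        l4 l5 l6 h2 h3 a b c && h2 && a)) && (r5 l2 l4 l5 a b || (hc l2 l3 l4 l5 l6 h2 h3 a b c &&
        h2 && b)))
    ((r2 l2' l4' l5' a' b' || (hc l2' l3' l4' l5' l6' h2' h3' a' b' c' && h2')) && (r4 l2' l4' l5'
        a' b' || (hc l2' l3' l4' l5' l6' h2' h3' a' b' c' && h2' && a')) && (r5 l2' l4' l5' a' b'
        || (hc l2' l3' l4' l5' l6' h2' h3' a' b' c' && h2' && b')))

/-- **The explicit ten-level enumeration** of the antipodal base case of the pinning pattern
`(s0, …, s9)` (`0` closed, `1` open, `2` free). -/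
def enum (s0 s1 s2 s3 s4 s5 s6 s7 s8 s9 : Fin 3) : ℤ :=
  ((choices s0).map fun c0 => ((choices s1).map fun c1 => ((choices s2).map fun c2 =>
    ((choices s3).map fun c3 => ((choices s4).map fun c4 => ((choices s5).map fun c5 =>
    ((choices s6).map fun c6 => ((choices s7).map fun c7 => ((choices s8).map fun c8 =>
    ((choices s9).map fun c9 =>
      leaf c0.1 c1.1 c2.1 c3.1 c4.1 c5.1 c6.1 c7.1 c8.1 c9.1
        c0.2 c1.2 c2.2 c3.2 c4.2 c5.2 c6.2 c7.2 c8.2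
            c9.2).sum).sum).sum).sum).sum).sum).sum).sum).sum).sum

/-- The leaf function on configurations. -/
def termTree (ω₁ ω₂ : Config (Fin 10)) : ℤ := tree (qB ω₁) (uB ω₁) (uB ω₂) (eB' ω₁) (eB' ω₂)

/-- `termTree` is `THBaseEnum.termOf` of the three deciders. -/
lemma termTree_eq : termTree = termOf qB uB eB' := by
  funext ω₁ ω₂
  exact tree_eq _ _ _ _ _

/-- **The nested enumerator of `THBaseEnum` is the explicit enumeration** (definitionally). -/
lemma kbGen_eq_enum (s : Fin 10 → Fin 3) :
    kbGen 10 s termTree = enum (s 0) (s 1) (s 2) (s 3) (s 4) (s 5) (s 6) (s 7) (s 8) (s 9) := rfl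

end Leaf

section Bridge

variable {R : Type*} [Field R] [DecidableEq R]

/-- **`kform` at a base case `(D, a)` is the explicit enumeration** of the pattern
`stateOf D a`. -/
theorem kform_eq_enum (D : Finset (Fin 10)) (a : Fin 10 → R)
    (ha : ∀ x, x ∉ D → a x = 0 ∨ a x = 1) :
    kform Q U e' D a =
      ((enum (stateOf D a 0) (stateOf D a 1) (stateOf D a 2) (stateOf D a 3) (stateOf D a 4)
        (stateOf D a 5) (stateOf D a 6) (stateOf D a 7) (stateOf D a 8) (stateOf D a 9) : ℤ) : R)
            := by
  rw [kform_eq_kbGen Q U e' qB uB eB' mem_Q_iff mem_U_iff mem_e'_iff D a ha, ← termTree_eq,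
    kbGen_eq_enum]

end Bridge

section Values

/-- **The main base case is `-1`**: every edge free. -/
lemma enum_main : enum 2 2 2 2 2 2 2 2 2 2 = -1 := by decide +kernel

/-- **The certificate pinning**: `x₂ x₅` closed (edge `8`), the rest free: the base case is `1`.
    -/
lemma enum_cert : enum 2 2 2 2 2 2 2 2 0 2 = 1 := by decide +kernel

/-- **Its antipode**: `x₂ x₅` open: the base case is `1`. -/
lemma enum_cert' : enum 2 2 2 2 2 2 2 2 1 2 = 1 := by decide +kernel

end Values

end THClassVP2

end Summit.Ventures.PercRepro2
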